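import Summits.ValiantsHypothesis.ValiantsHypothesis.Theorems.DepthWindowULPBReduction

/-!
# Route `DepthWindow` — `ULPB₂` from the carrier round: the schedule and the reduction

Cone-free sequel of `DepthWindowULPBReduction.lean` (decomp-valiant lens 4, g16; steps P4–P5 of the `ULPB₂`
plan, NODE-v16 §4b/§5.2) supporting the crux item `HomImmHardTwoOne` (stmt-ValiantsHypothesis-30635):

* `schedule_step`, `schedule_iter` — along the mass schedule `M_j = ⌊32h/2^j⌋` the scale obeys
  `v_j · 2^j · 7^(2^j − 1) ≤ h` (doubly exponential decay; one round: `(M − v)·v' ≤ 2v²`);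
* `final_arith_carrier` — `J = ⌊log₂⌊log₂ d⌋⌋ + 1` rounds give `d·v_J + 5h ≤ 128h`;
* `lowPathTreesAt_two_of_carrierRound` — `(∀ h ≥ 1, CarrierRound h) → LowPathTreesAt 2 402 3`;
* `universalLowTreeBiasAt_two_of_carrierRound` — hence `ULPB₂ = UniversalLowTreeBiasAt 2`: if the carrier
  round can be played (g17 target), every word has TREE bias `O(h)` at depth `2log₂log₂ d + 3`, and the
  lopsided relative-rank method gives nothing super-polynomial for set-multilinear FORMULAS at slope `2`
  (LST 2022 Thm. 3, converse direction; answers LST 2022 Question 1 in the large-depth regime);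
* `UniversalLowTreeBiasAt.mono`, `universalLowTreeBiasAt_iff_of_two`, `universalLowTreeBiasAt_iff_of_carrierRound` —
  the slope threshold is then exactly `2` (`UniversalLowTreeBiasAt C ↔ 2 ≤ C`, lower side BDS 2024 Thm. 2, landed).

References: [LimayeSrinivasanTavenas2022] CCC 2022 Question 1, Thm. 3; full version Prop. 17, Claim 28.
-/

-- layout Summits/ValiantsHypothesis/ValiantsHypothesis forces the duplicated namespace component
set_option linter.dupNamespace false

namespace Summit.ValiantsHypothesis.ValiantsHypothesis.Theorems.DepthWindow.TreeBias

open Finset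

variable {d : ℕ}

/-! ### The schedule: doubly exponential decay of the scale -/

/-- **One round of the schedule**: the invariant `v·2^j·7^(2^j − 1) ≤ h` propagates from round `j` to round
`j + 1` (masses `M_j = ⌊32h/2^j⌋`; once `2^j > h` the scale is already `0`). [folklore] -/
theorem schedule_step {h j v : ℕ} (hh : 1 ≤ h) (hInv : v * 2 ^ j * 7 ^ (2 ^ j - 1) ≤ h) :
    nxtScaleM (massAt h j) v * 2 ^ (j + 1) * 7 ^ (2 ^ (j + 1) - 1) ≤ h := by
  have hP1 : 1 ≤ 7 ^ (2 ^ j - 1) := Nat.one_le_pow _ _ (by norm_num)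
  have hvj : v * 2 ^ j ≤ h := le_trans (Nat.le_mul_of_pos_right _ hP1) hInv
  rcases le_or_gt (2 ^ j) h with hj | hj
  swap
  · -- the scale is already 0
    have hv : v = 0 := by
      rcases Nat.eq_zero_or_pos v with h0 | h0
      · exact h0
      · exfalso
        have : 2 ^ j ≤ v * 2 ^ j := Nat.le_mul_of_pos_left _ h0
        omega
    rw [hv, nxtScaleM_zero]; simp
  · set M := massAt h j with hM
    set P := 7 ^ (2 ^ j - 1) with hP
    have hMge := pow_mul_massAt_ge h j
    rw [← hM] at hMge
    obtain ⟨t, ht⟩ : ∃ t, M = v + t ∨ v = M + t := by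
      rcases le_total v M with h1 | h1
      · exact ⟨M - v, Or.inl (by omega)⟩
      · exact ⟨v - M, Or.inr (by omega)⟩
    have hvj' : 2 ^ j * v ≤ h := by rw [mul_comm]; exact hvj
    rcases ht with ht | ht
    · -- `M = v + t`, `2^j · t ≥ 30 h`
      have hsplit : 2 ^ j * M = 2 ^ j * v + 2 ^ j * t := by rw [ht, mul_add]
      have h30 : 30 * h ≤ 2 ^ j * t := by omega
      have hvM : v ≤ M := by omega
      have hb := nxtScaleM_bound M v hvM
      rw [show M - v = t by omega] at hb
      set e := nxtScaleM M v with he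
      have hpow : 7 ^ (2 ^ (j + 1) - 1) = 7 * (P * P) := by
        have h1 : 2 ^ (j + 1) - 1 = 1 + ((2 ^ j - 1) + (2 ^ j - 1)) := by
          have := Nat.one_le_two_pow (n := j)
          rw [pow_succ]; omega
        rw [h1, pow_add, pow_one, pow_add]
      rw [hpow]
      have key : 30 * h * (e * 2 ^ (j + 1) * (7 * (P * P))) ≤ 30 * h * h := by
        calc 30 * h * (e * 2 ^ (j + 1) * (7 * (P * P)))
            ≤ 2 ^ j * t * (e * 2 ^ (j + 1) * (7 * (P * P))) := Nat.mul_le_mul_right _ h30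
          _ = (t * e) * (2 ^ j * 2 ^ (j + 1) * 7 * (P * P)) := by ring
          _ ≤ (2 * v * v) * (2 ^ j * 2 ^ (j + 1) * 7 * (P * P)) := Nat.mul_le_mul_right _ hb
          _ = 28 * ((v * 2 ^ j * P) * (v * 2 ^ j * P)) := by rw [pow_succ]; ring
          _ ≤ 28 * (h * h) := Nat.mul_le_mul_left _ (Nat.mul_le_mul hInv hInv)
          _ ≤ 30 * h * h := by nlinarith
      exact Nat.le_of_mul_le_mul_left key (by omega)
    · -- `v ≥ M` is impossible in this regime (`31h < 2^j M ≤ 2^j v ≤ h`) unless `h = 0`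
      exfalso
      have : 2 ^ j * M ≤ 2 ^ j * v := Nat.mul_le_mul_left _ (by omega)
      omega

/-- **The schedule, iterated**: from round `j` at scale `v` with the invariant, `r` rounds later the invariant
holds at round `j + r`. [folklore] -/
theorem schedule_iter {h : ℕ} (hh : 1 ≤ h) : ∀ (r j v : ℕ), v * 2 ^ j * 7 ^ (2 ^ j - 1) ≤ h →
    scaleIter h j v r * 2 ^ (j + r) * 7 ^ (2 ^ (j + r) - 1) ≤ h := by
  intro r
  induction r with
  | zero => intro j v hv; simpa [scaleIter] using hv
  | succ r ih =>
    intro j v hv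
    rw [scaleIter_succ, show j + (r + 1) = (j + 1) + r by ring]
    exact ih (j + 1) _ (schedule_step hh hv)

/-- **The round count**: with `J = ⌊log₂⌊log₂ d⌋⌋ + 1` rounds from scale `h`, `d · v_J + 5h ≤ 128h`. [folklore] -/
theorem final_arith_carrier (d h : ℕ) (hh : 1 ≤ h) :
    d * scaleIter h 0 h (Nat.log 2 (Nat.log 2 d) + 1) + 5 * h ≤ 128 * h := by
  set J := Nat.log 2 (Nat.log 2 d) + 1 with hJ
  have hb := schedule_iter hh J 0 h (by simp)
  rw [zero_add] at hb
  set u := scaleIter h 0 h J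
  set P := 7 ^ (2 ^ J - 1) with hP
  have hm : Nat.log 2 d + 1 ≤ 2 ^ J := Nat.lt_pow_succ_log_self (by norm_num) _
  have hd : d < 2 ^ (2 ^ J) :=
    lt_of_lt_of_le (Nat.lt_pow_succ_log_self (by norm_num) d) (Nat.pow_le_pow_right (by norm_num) hm)
  have hJ1 : 1 ≤ 2 ^ J := Nat.one_le_two_pow
  have h63 : 2 ^ (2 ^ J) ≤ 63 * P := by
    calc 2 ^ (2 ^ J) ≤ 7 ^ (2 ^ J) := Nat.pow_le_pow_left (by norm_num) _
      _ = 7 * P := by rw [hP, ← pow_succ']; congr 1; omega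
      _ ≤ 63 * P := by omega
  have hdP : d ≤ 63 * P := by omega
  have huP : u * P ≤ h := by
    calc u * P = u * 1 * P := by ring
      _ ≤ u * 2 ^ J * P := Nat.mul_le_mul_right _ (Nat.mul_le_mul_left _ hJ1)
      _ ≤ h := hb
  calc d * u + 5 * h ≤ 63 * P * u + 5 * h := by nlinarith
    _ = 63 * (u * P) + 5 * h := by ring
    _ ≤ 63 * h + 5 * h := by nlinarith
    _ ≤ 128 * h := by omega

/-! ### The reduction -/

/-- Degenerate words (`‖w‖₁ ≤ β`, e.g. `h = 0` or `d = 0`): the padded star is a low-path tree of every depth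
`≥ 1` within budget `β`. [folklore] -/
theorem lowPathTree_of_sum_abs_le {w : Fin d → ℤ} {β : ℤ} (hw : ∑ i, |w i| ≤ β) {Δ : ℕ} (hΔ : 1 ≤ Δ) :
    LowPathTree w Δ β fun _ => β := by
  have h1 : LowPathTree w 1 β fun _ => β :=
    (lowPathTree_one hw).mono le_rfl fun i => by linarith [abs_nonneg (w i)]
  exact h1.depth_mono hΔ ((abs_sum_le_sum_abs _ _).trans hw)

/-- **`ULPB₂` from the carrier round.**  If `CarrierRound h` holds for every `h ≥ 1`, then every word has
uniform low-path trees at slope `2`: `LowPathTreesAt 2 402 3` (depth `2·⌊log₂⌊log₂ d⌋⌋ + 3`, node biases and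
path costs `≤ 402h`). [cite: LimayeSrinivasanTavenas2022, Question 1, Prop. 17] -/
theorem lowPathTreesAt_two_of_carrierRound (hR : ∀ h, 1 ≤ h → CarrierRound h) : LowPathTreesAt 2 402 3 := by
  intro d w h hw hsum
  have hΔ : 2 * Nat.log 2 (Nat.log 2 d) + 3 = 2 * (Nat.log 2 (Nat.log 2 d) + 1) + 1 := by ring
  rcases Nat.eq_zero_or_pos h with rfl | hh
  · -- the zero word
    have hw0 : ∑ i, |w i| ≤ (402 : ℕ) * ((0 : ℕ) : ℤ) := by
      have : ∀ i, |w i| = 0 := fun i => le_antisymm (by exact_mod_cast hw i) (abs_nonneg _)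
      simp [this]
    exact lowPathTree_of_sum_abs_le hw0 (by omega)
  rcases Nat.eq_zero_or_pos d with rfl | hd
  · -- no letters
    exact lowPathTree_of_sum_abs_le (by simp) (by omega)
  -- the carrier iteration from round 0, scale h, carrier = letter 0, no pending letters
  set κ : Fin d := ⟨0, hd⟩ with hκ
  have hP : pendSet w κ h = ∅ := by
    refine filter_false_of_mem fun i _ => ?_
    rw [not_and, not_lt]
    exact fun _ => hw i
  have hx : ∀ i, i ≠ κ → |w i| ≤ 2 * h := fun i _ => by linarith [hw i]
  have hD : |w κ - ∑ i, w i| ≤ 2 * h := by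
    have := abs_sub (w κ) (∑ i, w i); linarith [hw κ]
  have hI : (∑ i ∈ pendSet w κ h, |w i|) + |w κ + ∑ i ∈ pendSet w κ h, w i - ∑ i, w i| ≤
      |w κ - ∑ i, w i| := by
    rw [hP]; simp
  have hcount : (d : ℤ) * (scaleIter h 0 h (Nat.log 2 (Nat.log 2 d) + 1) : ℕ) + 5 * h ≤ 128 * h := by
    exact_mod_cast final_arith_carrier d h hh
  have hT := lowPathTree_of_carrierRound hh (hR h hh) (Nat.log 2 (Nat.log 2 d) + 1) 0 h w κ (by simp)
    hx hsum hD hI hcount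
  rw [hΔ]
  refine hT.mono (by push_cast; linarith) fun a => ?_
  have hM0 : massAt h 0 = 32 * h := by simp [massAt]
  split_ifs
  · push_cast; linarith
  · unfold budgetAt; rw [hM0]; push_cast; linarith

/-- **The reduction**: `CarrierRound h` for every `h ≥ 1` implies `ULPB₂` (`UniversalLowTreeBiasAt 2`): tree bias
`O(h)` — not only node bias — at depth `2log₂log₂ d + O(1)`, hence (LST 2022 Thm. 3, converse direction in
print) no super-polynomial lopsided-rank lower bound for set-multilinear FORMULAS at slope `2`.
[cite: LimayeSrinivasanTavenas2022, Question 1, Thm. 3] -/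
theorem universalLowTreeBiasAt_two_of_carrierRound (hR : ∀ h, 1 ≤ h → CarrierRound h) :
    UniversalLowTreeBiasAt 2 :=
  universalLowTreeBiasAt_of_lowPathTreesAt (by norm_num) (lowPathTreesAt_two_of_carrierRound hR)

/-- `ULPB_C` is monotone in the slope `C`. [folklore] -/
theorem UniversalLowTreeBiasAt.mono {C C' : ℕ} (hCC' : C ≤ C') (hyp : UniversalLowTreeBiasAt C) :
    UniversalLowTreeBiasAt C' := by
  obtain ⟨B, c₁, hB⟩ := hyp
  refine ⟨B, c₁, fun d w h hw hsum Δ hΔ => hB d w h hw hsum Δ ?_⟩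
  have : C * Nat.log 2 (Nat.log 2 d) ≤ C' * Nat.log 2 (Nat.log 2 d) := Nat.mul_le_mul_right _ hCC'
  omega

/-- Given `ULPB₂`, the slope threshold for uniform low TREE bias is exactly `2` (the lower side is the landed
`not_universalLowTreeBiasAt_one`, from BDS 2024 Thm. 2); with `universalLowTreeBiasAt_two_of_carrierRound` this makes
`CarrierRound` the single missing lemma for `UniversalLowTreeBiasAt C ↔ 2 ≤ C`. [cite: BhargavDuttaSaxena2024, Theorem 2] -/
theorem universalLowTreeBiasAt_iff_of_two (h2 : UniversalLowTreeBiasAt 2) (C : ℕ) :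
    UniversalLowTreeBiasAt C ↔ 2 ≤ C := by
  constructor
  · intro hC
    by_contra hlt
    rw [not_le] at hlt
    interval_cases C
    · exact not_universalLowTreeBiasAt_one (hC.mono (by norm_num))
    · exact not_universalLowTreeBiasAt_one hC
  · intro hC; exact h2.mono hC

/-- Hence: `(∀ h ≥ 1, CarrierRound h) → (UniversalLowTreeBiasAt C ↔ 2 ≤ C)`. [cite: LimayeSrinivasanTavenas2022, Question 1] -/
theorem universalLowTreeBiasAt_iff_of_carrierRound (hR : ∀ h, 1 ≤ h → CarrierRound h) (C : ℕ) :
    UniversalLowTreeBiasAt C ↔ 2 ≤ C :=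
  universalLowTreeBiasAt_iff_of_two (universalLowTreeBiasAt_two_of_carrierRound hR) C

end Summit.ValiantsHypothesis.ValiantsHypothesis.Theorems.DepthWindow.TreeBias
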